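import Summits.CriticalPhenomena.PercolationContinuityZ3.Theorems.PercNearOneGluingNoHeavyLowerTailE3FourPointGammaLeSix
import Literature.Probability.Percolation.KozmaNitzanPinning
import Literature.Combinatorics.Sahi2008.KahnQuestionOne

/-!
# `NoHeavyLowerTail` (crux stmt-CriticalPhenomena-4575): `GammaRow` on every finite vertex type with at most six vertices

Support file (prover seat `prim-ineq-prove-1` gen 24; `--supports stmt-CriticalPhenomena-4575`).  No definitions, no named facts, no
sorries, no `native_decide` here (computational only through the `n ≤ 6` rung `…E3FourPointGammaLeSix`).

`GammaRow` (`…CoSunflowerRows`, `@[conjecture]`, the last open four-point E3GRP class) reads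
`∀ V [Fintype V] (w : Sym2 V → [0,1]) (a b c y : V), 0 ≤ E₃(lnk[ab|cy], lnk[ac|by], lnk[ay|bc])`.
This file proves its restriction to `Fintype.card V ≤ 6` VERBATIM (`gammaRow_of_card_le_six`): for pairwise distinct terminals by
relabelling along `Fintype.equivFin V` (`prodBernoulli_map_restrictConfig`, `sahiE3_map`, `restrictConfig_symm_preimage_openConn`)
from `sahiE3_gamma_nonneg_le_six`; when two terminals coincide, two of the three group links are the sure event and `E₃ = 0`
(`sahiE3_eq_zero_of_univ₂₃` and its permutations).
[cite: LiebSahi2021, eq. (2.1) (the functional E₃)]; [cite: Kahn2022, Conj. 5 (arXiv p. 3)]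
-/

namespace Summit.CriticalPhenomena.PercolationContinuityZ3.Theorems.E3GroupSepCert

open MeasureTheory
open Literature.Probability.Percolation Literature.Probability.LatticeModels

/-! ## The group links as unions of two-point connections -/

section Links

variable {V : Type*} (p q r s : V)

/-- `lnk[pq|rs] = {p↔r} ∪ {p↔s} ∪ {q↔r} ∪ {q↔s}`. [folklore] -/
theorem setOf_lnk_eq_union :
    {ω : BondConfig V | ∃ x ∈ ({p, q} : Set V), ∃ z ∈ ({r, s} : Set V), (openGraph ω).Reachable x z} =
      (openConn p r ∪ openConn p s ∪ openConn q r ∪ openConn q s : Set (BondConfig V)) := by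
  ext ω
  simp only [Set.mem_setOf_eq, Set.mem_insert_iff, Set.mem_singleton_iff, Set.mem_union, openConn, exists_eq_or_imp,
    exists_eq_left]
  tauto

end Links

/-! ## Degenerate terminals: `E₃` with two sure events vanishes -/

section Degenerate

variable {Ω : Type*} [MeasurableSpace Ω] (μ : Measure Ω) [IsProbabilityMeasure μ] (A : Set Ω)

/-- `E₃(A, Ω, Ω) = 0`. [folklore] -/
theorem sahiE3_eq_zero_of_univ₂₃ : sahiE3 μ A Set.univ Set.univ = 0 := by
  rw [sahiE3_def]
  simp only [Set.inter_univ, probReal_univ]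
  ring

/-- `E₃(Ω, A, Ω) = 0`. [folklore] -/
theorem sahiE3_eq_zero_of_univ₁₃ : sahiE3 μ Set.univ A Set.univ = 0 := by
  rw [sahiE3_def]
  simp only [Set.inter_univ, Set.univ_inter, probReal_univ]
  ring

/-- `E₃(Ω, Ω, A) = 0`. [folklore] -/
theorem sahiE3_eq_zero_of_univ₁₂ : sahiE3 μ Set.univ Set.univ A = 0 := by
  rw [sahiE3_def]
  simp only [Set.univ_inter, probReal_univ]
  ring

end Degenerate

/-- A group link with a common terminal on both sides is the sure event. [folklore] -/
theorem setOf_lnk_eq_univ_of_mem {V : Type*} {X Y : Set V} {v : V} (hX : v ∈ X) (hY : v ∈ Y) :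
    {ω : BondConfig V | ∃ x ∈ X, ∃ z ∈ Y, (openGraph ω).Reachable x z} = Set.univ :=
  Set.eq_univ_of_forall fun _ => ⟨v, hX, v, hY, SimpleGraph.Reachable.refl _⟩

/-! ## `GammaRow` for at most six vertices -/

/-- **`GammaRow` on every finite vertex type with at most six vertices** — the registered conjecture `GammaRow`
(`0 ≤ E₃(lnk[ab|cy], lnk[ac|by], lnk[ay|bc])` for every weight vector and all `a b c y`) restricted to `Fintype.card V ≤ 6`,
with NO distinctness hypothesis: distinct terminals by the six-vertex rung `sahiE3_gamma_nonneg_le_six` transported along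
`Fintype.equivFin V`; coincident terminals make two of the links sure and `E₃ = 0`. [this work] -/
theorem gammaRow_of_card_le_six (V : Type) [Fintype V] (hV : Fintype.card V ≤ 6) (w : Sym2 V → unitInterval) (a b c y : V) :
    0 ≤ sahiE3 (prodBernoulli w)
      {ω : BondConfig V | ∃ x ∈ ({a, b} : Set V), ∃ z ∈ ({c, y} : Set V), (openGraph ω).Reachable x z}
      {ω : BondConfig V | ∃ x ∈ ({a, c} : Set V), ∃ z ∈ ({b, y} : Set V), (openGraph ω).Reachable x z}
      {ω : BondConfig V | ∃ x ∈ ({a, y} : Set V), ∃ z ∈ ({b, c} : Set V), (openGraph ω).Reachable x z} := by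
  classical
  -- coincident terminals: two sure links
  have ma : ∀ u v : V, u ∈ ({u, v} : Set V) := fun u v => by simp
  have mb : ∀ u v : V, v ∈ ({u, v} : Set V) := fun u v => by simp
  by_cases hab : a = b
  · rw [setOf_lnk_eq_univ_of_mem (X := ({a, c} : Set V)) (Y := ({b, y} : Set V)) (ma a c) (by rw [hab]; exact ma b y),
      setOf_lnk_eq_univ_of_mem (X := ({a, y} : Set V)) (Y := ({b, c} : Set V)) (ma a y) (by rw [hab]; exact ma b c)]
    exact le_of_eq (sahiE3_eq_zero_of_univ₂₃ _ _).symm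
  by_cases hac : a = c
  · rw [setOf_lnk_eq_univ_of_mem (X := ({a, b} : Set V)) (Y := ({c, y} : Set V)) (ma a b) (by rw [hac]; exact ma c y),
      setOf_lnk_eq_univ_of_mem (X := ({a, y} : Set V)) (Y := ({b, c} : Set V)) (ma a y) (by rw [hac]; exact mb b c)]
    exact le_of_eq (sahiE3_eq_zero_of_univ₁₃ _ _).symm
  by_cases hay : a = y
  · rw [setOf_lnk_eq_univ_of_mem (X := ({a, b} : Set V)) (Y := ({c, y} : Set V)) (ma a b) (by rw [hay]; exact mb c y),
      setOf_lnk_eq_univ_of_mem (X := ({a, c} : Set V)) (Y := ({b, y} : Set V)) (ma a c) (by rw [hay]; exact mb b y)]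
    exact le_of_eq (sahiE3_eq_zero_of_univ₁₂ _ _).symm
  by_cases hbc : b = c
  · rw [setOf_lnk_eq_univ_of_mem (X := ({a, b} : Set V)) (Y := ({c, y} : Set V)) (mb a b) (by rw [hbc]; exact ma c y),
      setOf_lnk_eq_univ_of_mem (X := ({a, c} : Set V)) (Y := ({b, y} : Set V)) (by rw [hbc]; exact mb a c) (ma b y)]
    exact le_of_eq (sahiE3_eq_zero_of_univ₁₂ _ _).symm
  by_cases hby : b = y
  · rw [setOf_lnk_eq_univ_of_mem (X := ({a, b} : Set V)) (Y := ({c, y} : Set V)) (mb a b) (by rw [hby]; exact mb c y),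
      setOf_lnk_eq_univ_of_mem (X := ({a, y} : Set V)) (Y := ({b, c} : Set V)) (by rw [hby]; exact mb a y) (ma b c)]
    exact le_of_eq (sahiE3_eq_zero_of_univ₁₃ _ _).symm
  by_cases hcy : c = y
  · rw [setOf_lnk_eq_univ_of_mem (X := ({a, c} : Set V)) (Y := ({b, y} : Set V)) (mb a c) (by rw [hcy]; exact mb b y),
      setOf_lnk_eq_univ_of_mem (X := ({a, y} : Set V)) (Y := ({b, c} : Set V)) (by rw [hcy]; exact mb a y) (mb b c)]
    exact le_of_eq (sahiE3_eq_zero_of_univ₂₃ _ _).symm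
  -- distinct terminals: transport the `Fin (card V)` theorem along `Fintype.equivFin V`
  set e := Fintype.equivFin V with he
  have hf : Function.Injective (e.symm : Fin (Fintype.card V) → V) := e.symm.injective
  have key := sahiE3_gamma_nonneg_le_six (Fintype.card V) hV (w ∘ Sym2.map e.symm) (e a) (e b) (e c) (e y)
    (e.injective.ne hab) (e.injective.ne hac) (e.injective.ne hay) (e.injective.ne hbc) (e.injective.ne hby)
    (e.injective.ne hcy)
  rw [← prodBernoulli_map_restrictConfig w hf, Literature.Combinatorics.Sahi2008.Kahn2022.sahiE3_map] at key
  simp only [Set.preimage_union, restrictConfig_symm_preimage_openConn] at key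
  rw [setOf_lnk_eq_union, setOf_lnk_eq_union, setOf_lnk_eq_union, KNPreFKG.openConn_symm c b,
    KNPreFKG.openConn_symm y b, KNPreFKG.openConn_symm y c]
  exact key

end Summit.CriticalPhenomena.PercolationContinuityZ3.Theorems.E3GroupSepCert
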